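import Summits.FinalStateConjecture.FinalStateConjecture.Theorems.EIHFluxBalanceLLBalanceLawIdentities

/-!
# Window charges (stub `stub_windowCharges`): pointwise Landau–Lifshitz identities, slice calculus

Helper file for the line `sublinear-is-free-clean-window-charges` of the crux `InertialRecession`
(item `stmt-FinalStateConjecture-10166`), stub `stub_windowCharges`.

Pointwise facts about the Landau–Lifshitz objects of
`Literature.Geometry.Lorentzian.LandauLifshitzPseudotensor` entering the moving-sphere balance law
(LL §96, (96.10)–(96.12)):

* `metricDet_ne_zero_of_norm_sub_minkowski_le` — components within operator-norm distance `1/2` of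
  the Minkowski form are nondegenerate (`η⁻¹ = η` has norm one);
* `abs_emComplex_le_of_pseudotensor_bound` — in vacuum (`Ric = 0`) the complex `Σ_α ∂_α h^{μνα}`
  equals `−(det g) t^{μν}_LL`, so a bound on the densitised pseudotensor bounds it;
* `emComplex_zero_eq_sum_partialDeriv` — `(−g)(T + t)^{μ0} = Σ_k ∂_k h^{μ0k}` is a SPATIAL
  divergence (`h^{μ00} = 0`);
* `partialDeriv_zero_hField_eq` — `∂_0 h^{μ0j} = −(−g)(T + t)^{μj} + Σ_k ∂_k h^{μjk}` (antisymmetry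
  `h^{μj0} = −h^{μ0j}`): the time derivative of the momentum density is minus the flux density plus
  the divergence of the antisymmetric spatial tensor `h^{μjk}` (whose closed-surface flux vanishes);
* the affine slice maps `y ↦ (t, y)` of `E4 = ℝ × E3`: a continuous linear `L : E3 →L E4` with
  `L w = (0, w)`, the chain rules along slices and along moving points `s ↦ (s, c(s) + R(s) v)`.
-/

noncomputable section

open Set Filter Metric
open scoped Topology

namespace Summit.FinalStateConjecture.FinalStateConjecture.Theorems.SublinearIsFree.WindowCharges

open Literature.Geometry.Lorentzian Literature.Geometry.Lorentzian.LandauLifshitz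

variable {g : E4 → E4 →L[ℝ] E4 →L[ℝ] ℝ}

/-! ### Nondegeneracy near the Minkowski form -/

/-- Expansion of a vector of `E4` in the coordinate basis: `w = Σ_μ w^μ ∂_μ`. [folklore] -/
theorem sum_apply_smul_basisVector (w : E4) : ∑ μ : Fin 4, w μ • E4.basisVector μ = w := by
  ext ν
  simp [Pi.single_apply]

/-- **Components `1/2`-close to Minkowski are nondegenerate**: if `‖g(x) − η‖ ≤ 1/2` (operator norm
of bilinear forms on Euclidean `E4`) then `det (g_{μν}(x)) ≠ 0`. Indeed a kernel vector `w` of the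
Gram matrix has `g(x)(u, w) = 0` for all `u`; with the time-reversed `u = w − 2w⁰∂₀` one has
`η(u, w) = ‖w‖²` and `‖u‖ = ‖w‖`, so `‖w‖² = |(g(x) − η)(u, w)| ≤ ‖w‖²/2`. [folklore] -/
theorem metricDet_ne_zero_of_norm_sub_minkowski_le' {x : E4}
    (h : ‖g x - Minkowski.bilin‖ ≤ 1 / 2) : metricDet g x ≠ 0 := by
  intro hdet
  obtain ⟨v, hv, hmul⟩ := Matrix.exists_mulVec_eq_zero_iff.2 hdet
  set w : E4 := WithLp.toLp 2 v with hw
  have hwv : ∀ μ, w μ = v μ := fun μ ↦ rfl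
  -- `g(x)(∂_μ, w) = (G v)_μ = 0`
  have h1 : ∀ μ, g x (E4.basisVector μ) w = 0 := by
    intro μ
    have hμ := congrFun hmul μ
    rw [Matrix.mulVec, dotProduct] at hμ
    rw [Pi.zero_apply] at hμ
    rw [← sum_apply_smul_basisVector w, map_sum]
    simp only [map_smul, smul_eq_mul, hwv]
    refine (Finset.sum_congr rfl fun ν _ ↦ ?_).trans hμ
    rw [gram_apply, mul_comm]
  -- hence `g(x)(u, w) = 0` for every `u`
  have h2 : ∀ u : E4, g x u w = 0 := by
    intro u
    rw [← sum_apply_smul_basisVector u, map_sum]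
    simp [_root_.sum_apply, h1]
  -- the time-reversed vector
  set u : E4 := w - (2 * w 0) • E4.basisVector 0 with hu
  have hu0 : u 0 = -w 0 := by
    simp [hu]
    ring
  have hus : ∀ i : Fin 3, u i.succ = w i.succ := fun i ↦ by
    simp [hu, Fin.succ_ne_zero]
  have hnw : ‖w‖ ^ 2 = w 0 ^ 2 + ∑ i : Fin 3, w i.succ ^ 2 := by
    rw [EuclideanSpace.real_norm_sq_eq, Fin.sum_univ_succ]
  have hnu : ‖u‖ = ‖w‖ := by
    have hsq : ‖u‖ ^ 2 = ‖w‖ ^ 2 := by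
      rw [hnw, EuclideanSpace.real_norm_sq_eq, Fin.sum_univ_succ, hu0, neg_sq]
      simp only [hus]
    nlinarith [norm_nonneg u, norm_nonneg w, hsq]
  have heta : Minkowski.bilin u w = ‖w‖ ^ 2 := by
    rw [Minkowski.bilin_apply, hnw, hu0]
    simp only [hus]
    ring_nf
  have hdiff : (g x - Minkowski.bilin) u w = -‖w‖ ^ 2 := by
    rw [_root_.sub_apply, _root_.sub_apply, h2 u, heta, zero_sub]
  have hle : ‖w‖ ^ 2 ≤ 1 / 2 * ‖w‖ ^ 2 := by
    have h3 := (g x - Minkowski.bilin).le_opNorm₂ u w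
    rw [hdiff, norm_neg, Real.norm_eq_abs, abs_of_nonneg (sq_nonneg _), hnu] at h3
    calc ‖w‖ ^ 2 ≤ ‖g x - Minkowski.bilin‖ * ‖w‖ * ‖w‖ := h3
      _ ≤ 1 / 2 * ‖w‖ * ‖w‖ := by gcongr
      _ = 1 / 2 * ‖w‖ ^ 2 := by ring
  have hw0 : w = 0 := by
    have : ‖w‖ ^ 2 = 0 := by nlinarith [sq_nonneg ‖w‖]
    exact norm_eq_zero.1 (pow_eq_zero_iff two_ne_zero |>.1 this)
  apply hv
  funext μ
  rw [← hwv, hw0]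
  rfl

/-- **Components `1/2`-close to Minkowski are nondegenerate** — the registered sub-goal form
(stub `metricDet_ne_zero_of_norm_sub_minkowski_le` of the crux item) of
`metricDet_ne_zero_of_norm_sub_minkowski_le'`. [folklore] -/
theorem metricDet_ne_zero_of_norm_sub_minkowski_le : open Literature.Geometry.Lorentzian Literature.Geometry.Lorentzian.LandauLifshitz in ∀ (g : E4 → E4 →L[ℝ] E4 →L[ℝ] ℝ) (x : E4), ‖g x - Minkowski.bilin‖ ≤ 1 / 2 → metricDet g x ≠ 0 :=
  fun _ _ h ↦ metricDet_ne_zero_of_norm_sub_minkowski_le' h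

/-! ### The complex in vacuum is the densitised pseudotensor -/

/-- **The pseudotensor bound controls the complex in vacuum**: if `det (g_{μν}(x)) ≠ 0`,
`Ric(g)(x) = 0` and `|det g(x) · t^{μν}_LL(x)| ≤ C b²` for all `μ ν`, then
`|Σ_α ∂_α h^{μνα}(x)| ≤ C b²` — for then `Σ_α ∂_α h^{μνα} = (−g) t^{μν}` (LL (96.11): `T = 0`).
[cite: LandauLifshitz1975, §96 (96.11)] -/
theorem abs_emComplex_le_of_pseudotensor_bound {x : E4} {C b : ℝ} (hdet : metricDet g x ≠ 0)
    (hric : MetricCoord.ricAt g x = 0)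
    (hb : ∀ μ ν : Fin 4, |metricDet g x * pseudotensor g x μ ν| ≤ C * b ^ 2) (μ ν : Fin 4) :
    |emComplex g x μ ν| ≤ C * b ^ 2 := by
  have h := LLBalance.emComplex_eq_neg_metricDet_mul hdet μ ν
  rw [LLBalance.einsteinUpper_eq_zero_of_ricAt_eq_zero hric, mul_zero, zero_add, neg_mul] at h
  rw [h, abs_neg]
  exact hb μ ν

/-! ### Spatial divergence and time derivative of the momentum density -/

/-- **The momentum density is a spatial divergence**: `Σ_α ∂_α h^{μ0α}(x) = Σ_k ∂_k h^{μ0k}(x)`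
(`h^{μ00} = 0` identically, LL (96.4)), LL's derivation of (96.16).
[cite: LandauLifshitz1975, §96 (96.16)] -/
theorem emComplex_zero_eq_sum_partialDeriv (x : E4) (μ : Fin 4) :
    emComplex g x μ 0 = ∑ k : Fin 3, partialDeriv k.succ (fun y ↦ hField g y μ 0 k.succ) x := by
  rw [emComplex, Fin.sum_univ_succ]
  have h0 : (fun y ↦ hField g y μ 0 0) = fun _ ↦ (0 : ℝ) := funext fun y ↦ hField_self g y μ 0
  rw [h0, partialDeriv, fderiv_const_apply]
  simp

/-- **Time derivative of the momentum density** (LL (96.10)–(96.12) in components): identically,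
`∂_0 h^{μ0j}(x) = −Σ_α ∂_α h^{μjα}(x) + Σ_k ∂_k h^{μjk}(x)`, because `h^{μj0} = −h^{μ0j}`
(LL (96.4)). The last term is the divergence of the ANTISYMMETRIC spatial tensor `h^{μjk}`, whose
flux through a closed surface vanishes. [cite: LandauLifshitz1975, §96 (96.12)] -/
theorem partialDeriv_zero_hField_eq (x : E4) (μ : Fin 4) (j : Fin 3) :
    partialDeriv 0 (fun y ↦ hField g y μ 0 j.succ) x =
      -emComplex g x μ j.succ +
        ∑ k : Fin 3, partialDeriv k.succ (fun y ↦ hField g y μ j.succ k.succ) x := by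
  have hswap : (fun y ↦ hField g y μ j.succ 0) = fun y ↦ -hField g y μ 0 j.succ :=
    funext fun y ↦ hField_swap g y μ 0 j.succ
  have h : emComplex g x μ j.succ = -partialDeriv 0 (fun y ↦ hField g y μ 0 j.succ) x +
      ∑ k : Fin 3, partialDeriv k.succ (fun y ↦ hField g y μ j.succ k.succ) x := by
    rw [emComplex, Fin.sum_univ_succ, hswap, partialDeriv, partialDeriv, fderiv_fun_neg]
    rfl
  linarith

/-! ### Slice calculus on `E4 = ℝ × E3` -/

/-- `(t, y) = t ∂₀ + (0, y)`. [folklore] -/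
theorem ofTimeSpace_eq_smul_add_ofTimeSpace_zero (t : ℝ) (y : E3) :
    E4.ofTimeSpace t y = t • E4.basisVector 0 + E4.ofTimeSpace 0 y := by
  ext i
  refine Fin.cases ?_ (fun j ↦ ?_) i
  · simp
  · simp [Fin.succ_ne_zero]

/-- `(0, w) = Σ_k w_k ∂_{k+1}`. [folklore] -/
theorem ofTimeSpace_zero_eq_sum (w : E3) :
    E4.ofTimeSpace 0 w = ∑ k : Fin 3, w k • E4.basisVector k.succ := by
  ext i
  refine Fin.cases ?_ (fun j ↦ ?_) i
  · simp [Fin.succ_ne_zero]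
  · simp [Pi.single_apply, Fin.succ_inj]

/-- `(0, ·)` is additive. [folklore] -/
theorem ofTimeSpace_zero_add (w w' : E3) :
    E4.ofTimeSpace 0 (w + w') = E4.ofTimeSpace 0 w + E4.ofTimeSpace 0 w' := by
  simp only [ofTimeSpace_zero_eq_sum, PiLp.add_apply, add_smul, Finset.sum_add_distrib]

/-- `(0, ·)` is homogeneous. [folklore] -/
theorem ofTimeSpace_zero_smul (a : ℝ) (w : E3) :
    E4.ofTimeSpace 0 (a • w) = a • E4.ofTimeSpace 0 w := by
  simp only [ofTimeSpace_zero_eq_sum, PiLp.smul_apply, smul_eq_mul, mul_smul, Finset.smul_sum]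

/-- **The spatial embedding as a continuous linear map**: there is `L : E3 →L[ℝ] E4` with
`L w = (0, w)`. [folklore] -/
theorem exists_clm_ofTimeSpace_zero : ∃ L : E3 →L[ℝ] E4, ∀ w, L w = E4.ofTimeSpace 0 w := by
  refine ⟨∑ k : Fin 3, (EuclideanSpace.proj k : E3 →L[ℝ] ℝ).smulRight (E4.basisVector k.succ),
    fun w ↦ ?_⟩
  rw [ofTimeSpace_zero_eq_sum]
  simp [_root_.sum_apply, ContinuousLinearMap.smulRight_apply]

/-- **Derivatives along moving spatial points**: if `c` and `R` have derivatives `c'`, `R'` at `s`,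
then `s ↦ (s, c(s) + R(s) v)` has derivative `(1, c' + R' v)` at `s`. [folklore] -/
theorem hasDerivAt_ofTimeSpace_moving {c : ℝ → E3} {R : ℝ → ℝ} {c' : E3} {R' : ℝ} {s : ℝ}
    (hc : HasDerivAt c c' s) (hR : HasDerivAt R R' s) (v : E3) :
    HasDerivAt (fun s ↦ E4.ofTimeSpace s (c s + R s • v)) (E4.ofTimeSpace 1 (c' + R' • v)) s := by
  obtain ⟨L, hL⟩ := exists_clm_ofTimeSpace_zero
  have hfun : (fun s ↦ E4.ofTimeSpace s (c s + R s • v)) =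
      fun s ↦ s • E4.basisVector 0 + L (c s + R s • v) := by
    funext s
    rw [ofTimeSpace_eq_smul_add_ofTimeSpace_zero, hL]
  have h : HasDerivAt (fun s ↦ s • E4.basisVector 0 + L (c s + R s • v))
      ((1 : ℝ) • E4.basisVector 0 + L (c' + R' • v)) s :=
    ((hasDerivAt_id s).smul_const (E4.basisVector 0)).add
      (L.hasFDerivAt.comp_hasDerivAt s (hc.add (hR.smul_const v)))
  rw [hfun, ofTimeSpace_eq_smul_add_ofTimeSpace_zero, ← hL]
  exact h

/-- **The slice maps are affine**: `z ↦ (t, ξ + z)` has derivative `w ↦ (0, w)` everywhere, in the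
form `HasFDerivAt … L z` for the continuous linear `L` of `exists_clm_ofTimeSpace_zero`.
[folklore] -/
theorem hasFDerivAt_slice {L : E3 →L[ℝ] E4} (hL : ∀ w, L w = E4.ofTimeSpace 0 w) (t : ℝ)
    (ξ z : E3) : HasFDerivAt (fun z ↦ E4.ofTimeSpace t (ξ + z)) L z := by
  have hfun : (fun z ↦ E4.ofTimeSpace t (ξ + z)) =
      fun z ↦ (t • E4.basisVector 0 + L ξ) + L z := by
    funext z
    rw [ofTimeSpace_eq_smul_add_ofTimeSpace_zero, ofTimeSpace_zero_add, hL, hL, add_assoc]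
  rw [hfun]
  exact (L.hasFDerivAt).const_add _

/-- The slice map `z ↦ (t, ξ + z)` is `C^∞`. [folklore] -/
theorem contDiff_slice (t : ℝ) (ξ : E3) {n : WithTop ℕ∞} :
    ContDiff ℝ n fun z ↦ E4.ofTimeSpace t (ξ + z) := by
  obtain ⟨L, hL⟩ := exists_clm_ofTimeSpace_zero
  have hfun : (fun z ↦ E4.ofTimeSpace t (ξ + z)) =
      fun z ↦ (t • E4.basisVector 0 + L ξ) + L z := by
    funext z
    rw [ofTimeSpace_eq_smul_add_ofTimeSpace_zero, ofTimeSpace_zero_add, hL, hL, add_assoc]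
  rw [hfun]
  exact contDiff_const.add L.contDiff

/-- **Chain rule along a slice**: for `H` differentiable at `x = (t, ξ + z)`,
`D[z ↦ H(t, ξ + z)](z) w = DH(x)(0, w)`. [folklore] -/
theorem fderiv_comp_slice_apply {H : E4 → ℝ} {t : ℝ} {ξ z : E3}
    (hH : DifferentiableAt ℝ H (E4.ofTimeSpace t (ξ + z))) (w : E3) :
    fderiv ℝ (fun z ↦ H (E4.ofTimeSpace t (ξ + z))) z w =
      fderiv ℝ H (E4.ofTimeSpace t (ξ + z)) (E4.ofTimeSpace 0 w) := by
  obtain ⟨L, hL⟩ := exists_clm_ofTimeSpace_zero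
  have h : HasFDerivAt (fun z ↦ H (E4.ofTimeSpace t (ξ + z)))
      ((fderiv ℝ H (E4.ofTimeSpace t (ξ + z))).comp L) z :=
    hH.hasFDerivAt.comp z (hasFDerivAt_slice hL t ξ z)
  rw [h.fderiv, ContinuousLinearMap.comp_apply, hL]

/-- **Directional derivatives along `(0, w)` in coordinates**: `DH(x)(0, w) = Σ_k w_k ∂_{k+1} H(x)`.
[folklore] -/
theorem fderiv_apply_ofTimeSpace_zero (H : E4 → ℝ) (x : E4) (w : E3) :
    fderiv ℝ H x (E4.ofTimeSpace 0 w) = ∑ k : Fin 3, w k * partialDeriv k.succ H x := by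
  rw [ofTimeSpace_zero_eq_sum, map_sum]
  simp only [map_smul, smul_eq_mul, partialDeriv]

/-- **Directional derivatives along `(1, w)` in coordinates**:
`DH(x)(1, w) = ∂_0 H(x) + Σ_k w_k ∂_{k+1} H(x)`. [folklore] -/
theorem fderiv_apply_ofTimeSpace_one (H : E4 → ℝ) (x : E4) (w : E3) :
    fderiv ℝ H x (E4.ofTimeSpace 1 w) =
      partialDeriv 0 H x + ∑ k : Fin 3, w k * partialDeriv k.succ H x := by
  rw [ofTimeSpace_eq_smul_add_ofTimeSpace_zero, one_smul, map_add, fderiv_apply_ofTimeSpace_zero,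
    partialDeriv]

end Summit.FinalStateConjecture.FinalStateConjecture.Theorems.SublinearIsFree.WindowCharges

end
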